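import Mathlib
import Summits.MatrixMultiplication.Statement
import Summits.MatrixMultiplication.MatrixMultiplication.Theorems.GraphEquationsKernelSection

/-!
# GraphEquations — TRIVIAL FIBRES VIA THE NULLSTELLENSATZ (M18f-2, decomp-mm-lens-5 g31)

(supports `MultiplicityReduction`, stmt-MatrixMultiplication-27806, hand 1 = BOP′ at `K = 2`;
pure algebra, first half of the proof of `IsoLocusOpen`.)

For a set / family of polynomials over `ℂ` in finitely many unknowns:
* `exists_X_pow_mem_of_trivialZero` — if the only common zero is `0`, every coordinate has a power in
  the ideal (Hilbert's Nullstellensatz, `MvPolynomial.vanishingIdeal_zeroLocus_eq_radical`);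
* `exists_degree_monomials_mem` — hence ALL monomials of some degree `N ≥ max(B,1)` lie in the ideal;
* `homogeneousComponent_mul_of_isHomogeneous` — `(a·P)_N = a_{N-e}·P` for a form `P` of degree `e ≤ N`;
* `exists_homogeneous_repr` — a form of degree `N` in the ideal of forms `P_o` (`deg P_o ≤ N`) is
  `∑ b_o P_o` with `b_o` homogeneous of degree `N - deg P_o`;
* `trivialZero_of_monomials_mem` — conversely, if all monomials of a degree `N ≥ 1` lie in the ideal,
  the only common zero is `0`.

No `sorry`.  Sources: [CoxLittleOShea2015, Ch. 4 §1–2, Ch. 8 §5].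
-/

set_option linter.dupNamespace false

noncomputable section

open scoped BigOperators

namespace Summit.MatrixMultiplication.MatrixMultiplication.Theorems.GraphEquations

open MvPolynomial

variable {κ : Type*}

/-! ## Powers of the coordinates in the ideal -/

section fintype

variable [Fintype κ]

/-- If a set of polynomials over `ℂ` has only the trivial common zero, every coordinate function has a
power in the ideal it generates (Nullstellensatz). -/
theorem exists_X_pow_mem_of_trivialZero (S : Set (MvPolynomial κ ℂ))
    (h0 : ∀ F : κ → ℂ, (∀ p ∈ S, eval F p = 0) → F = 0) (q : κ) :
    ∃ m : ℕ, (X q : MvPolynomial κ ℂ) ^ m ∈ Ideal.span S := by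
  have hX : (X q : MvPolynomial κ ℂ) ∈ vanishingIdeal ℂ (zeroLocus ℂ (Ideal.span S)) := by
    rw [mem_vanishingIdeal_iff]
    intro F hF
    rw [zeroLocus_span] at hF
    have hF0 : F = 0 := h0 F fun p hp => by
      have h := hF p hp
      rwa [aeval_eq_eval] at h
    rw [hF0, aeval_X, Pi.zero_apply]
  rw [vanishingIdeal_zeroLocus_eq_radical] at hX
  exact Ideal.mem_radical_iff.mp hX

/-- **All monomials of some degree lie in the ideal.**  If `S` has only the trivial common zero then,
for any bound `B`, there is `N ≥ max(B, 1)` with every monomial of degree `N` in `Ideal.span S`. -/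
theorem exists_degree_monomials_mem (S : Set (MvPolynomial κ ℂ))
    (h0 : ∀ F : κ → ℂ, (∀ p ∈ S, eval F p = 0) → F = 0) (B : ℕ) :
    ∃ N : ℕ, B ≤ N ∧ 1 ≤ N ∧
      ∀ m : κ →₀ ℕ, m.degree = N → monomial m (1 : ℂ) ∈ Ideal.span S := by
  classical
  choose e he using exists_X_pow_mem_of_trivialZero S h0
  refine ⟨∑ q, e q + B + 1, by omega, by omega, fun m hm => ?_⟩
  have hq : ∃ q, e q ≤ m q := by
    by_contra h
    push Not at h
    have hle : m.degree ≤ ∑ q, e q := by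
      rw [Finsupp.degree_eq_sum]
      exact Finset.sum_le_sum fun q _ => (h q).le
    omega
  obtain ⟨q, hq⟩ := hq
  have hsplit : monomial m (1 : ℂ) = X q ^ e q * monomial (m - Finsupp.single q (e q)) 1 := by
    rw [X_pow_eq_monomial, monomial_mul, one_mul,
      add_tsub_cancel_of_le (Finsupp.single_le_iff.mpr hq)]
  rw [hsplit]
  exact Ideal.mul_mem_right _ _ (he q)

end fintype

/-! ## Homogeneous bookkeeping -/

/-- `(a·P)_N = a_{N-e}·P` for a form `P` of degree `e ≤ N`. -/
theorem homogeneousComponent_mul_of_isHomogeneous {R σ : Type*} [CommSemiring R]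
    (a P : MvPolynomial σ R) {e N : ℕ} (hP : P.IsHomogeneous e) (he : e ≤ N) :
    homogeneousComponent N (a * P) = homogeneousComponent (N - e) a * P := by
  classical
  ext c
  rw [coeff_homogeneousComponent, coeff_mul, coeff_mul]
  split_ifs with hc
  · refine Finset.sum_congr rfl fun x hx => ?_
    rw [coeff_homogeneousComponent]
    by_cases hx2 : coeff x.2 P = 0
    · simp [hx2]
    · have hdeg2 : x.2.degree = e := by
        by_contra h
        exact hx2 (hP.coeff_eq_zero h)
      have hsum : x.1 + x.2 = c := Finset.HasAntidiagonal.mem_antidiagonal.mp hx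
      have hdeg1 : x.1.degree = N - e := by
        have h := congrArg Finsupp.degree hsum
        rw [map_add, hdeg2, hc] at h
        omega
      rw [if_pos hdeg1]
  · symm
    refine Finset.sum_eq_zero fun x hx => ?_
    rw [coeff_homogeneousComponent]
    split_ifs with h1
    · by_cases hx2 : coeff x.2 P = 0
      · simp [hx2]
      · exfalso
        have hdeg2 : x.2.degree = e := by
          by_contra h
          exact hx2 (hP.coeff_eq_zero h)
        have hsum : x.1 + x.2 = c := Finset.HasAntidiagonal.mem_antidiagonal.mp hx
        apply hc
        have h := congrArg Finsupp.degree hsum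
        rw [map_add, hdeg2, h1] at h
        omega
    · simp

/-- **Homogeneous representation.**  A form of degree `N` lying in the ideal of forms `P_o` of
degrees `d_o ≤ N` is `∑ b_o P_o` with `b_o` homogeneous of degree `N - d_o`. -/
theorem exists_homogeneous_repr {ι : Type*} [Fintype ι] (P : ι → MvPolynomial κ ℂ) (d : ι → ℕ)
    (hP : ∀ o, (P o).IsHomogeneous (d o)) {N : ℕ} (hdN : ∀ o, d o ≤ N)
    {p : MvPolynomial κ ℂ} (hp : p.IsHomogeneous N) (hmem : p ∈ Ideal.span (Set.range P)) :
    ∃ b : ι → MvPolynomial κ ℂ, (∀ o, (b o).IsHomogeneous (N - d o)) ∧ ∑ o, b o * P o = p := by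
  obtain ⟨a, ha⟩ := Ideal.mem_span_range_iff_exists_fun.mp hmem
  refine ⟨fun o => homogeneousComponent (N - d o) (a o),
    fun o => homogeneousComponent_isHomogeneous _ _, ?_⟩
  calc ∑ o, homogeneousComponent (N - d o) (a o) * P o
        = ∑ o, homogeneousComponent N (a o * P o) := by
          refine Finset.sum_congr rfl fun o _ => ?_
          rw [homogeneousComponent_mul_of_isHomogeneous _ _ (hP o) (hdN o)]
    _ = homogeneousComponent N (∑ o, a o * P o) := by rw [_root_.map_sum]
    _ = p := by rw [ha, homogeneousComponent_eq_self hp]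

/-! ## Monomials in the ideal force the trivial fibre -/

/-- If all monomials of some degree `N ≥ 1` lie in `Ideal.span S`, the only common zero of `S` is `0`. -/
theorem trivialZero_of_monomials_mem (S : Set (MvPolynomial κ ℂ)) {N : ℕ} (hN : 1 ≤ N)
    (hmon : ∀ m : κ →₀ ℕ, m.degree = N → monomial m (1 : ℂ) ∈ Ideal.span S) :
    ∀ F : κ → ℂ, (∀ p ∈ S, eval F p = 0) → F = 0 := by
  intro F hF
  funext q
  have hle : Ideal.span S ≤ RingHom.ker (eval F) :=
    Ideal.span_le.mpr fun p hp => by simpa [RingHom.mem_ker] using hF p hp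
  have hmem := hle (hmon (Finsupp.single q N) (by simp [Finsupp.degree_single]))
  rw [RingHom.mem_ker, ← X_pow_eq_monomial, map_pow, eval_X] at hmem
  rw [Pi.zero_apply]
  exact (pow_eq_zero_iff (by omega)).mp hmem

end Summit.MatrixMultiplication.MatrixMultiplication.Theorems.GraphEquations

end
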